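import Mathlib
import Summits.KontsevichZagierPeriods.Zeta5Search.BrickLambdaCirc
import Summits.KontsevichZagierPeriods.Zeta5Search.BrickResidueLawMain

/-!
# BrickResidueLawCirc — THEOREM 7/8 LEMMA 2 (ii), the RESIDUE LAW at EVERY level for EVERY ° cell:
`r_j^{(s)}(n) ≡ λ_j·r̃_{J}^{(s)}(N) (mod p^Λ)`, `s ∈ {0} ∪ [1,A]`, with NO level hypothesis (cell zeta5-irr)

HONEST FRAMING: systematic search; no irrationality claim unless certified. INSTRUMENT lemmas of the ζ(5)
census cell zeta5-irr (HOME `run/shared/lean/pub/zeta5-irr/`; memo `zi-p2/probes/B8/thm7/THEOREM7.md` §2 LEMMA 2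
«(ii) RESIDUE LAW: if Λ ≤ A − B then for every s ∈ {0} ∪ [1,A]: v(r_K^{(s)}(N) − λ_K·r̃_{K′}^{(s)}(N′)) ≥ Λ … CASE
δ_b ≠ −1 (no lost member) … [The hypothesis Λ ≤ A−B is used ONLY in the sub-case y_l = p^Λ …]»; design note HOME
`zi-eng/lean-g8/DESIGN-LEMMA2-TYPES.md` (R1)). Here: every ° cell (`c_h = 0`: `j₀ ≤ n₀`; carries `c_a, c_b, c_c`
arbitrary; `2j ≠ n` or `ε = 0`) at every level, and — answering (R1) on the kernel side — NO hypothesis `Λ ≤ A − B` is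
needed: the boundary polynomial is paid for by the constant, `a·E_j ∈ ℤ_(p)[T]` with `a·[T^h]E_j ∈ pℤ_(p)` for `h ≥ 1`.
Nothing here is about ζ(5); no irrationality content; filing moves no rung. Filed by the engine seat zi-eng (g9);
sequel of `BrickResidueLawMain` (zi-eng g8: MAIN cells, `E_j = 1`), `BrickDigitStripCirc` ((★) with `E_j`) and
`BrickLambdaCirc` (`v_p(a) = deg E_j`).

## The statements

`p` odd prime, `2B ≤ A`, `n = n₀ + Np`, `j = j₀ + Jp` with `j₀ ≤ n₀ < p`, `J ≤ N < p^{L+1}`, `2j ≠ n ∨ ε = 0`;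
`λ` any rational with `λ·cTop A B 0 N J = cTop A B ε n j` (i.e. `λ_j = c_{j,A}(n)/c̃_{J,A}(N)`; stated
multiplicatively so that no division appears):
* `lambda_circ`: `v(λ) ≤ exp(−m)`, `m = B c_a + B c_b + ε c_c`; `lambda_circ_le_one`: `λ ∈ ℤ_(p)`;
* **`residueLaw_circ_depth`** (every depth `d`): `v(p^{(L+1)d}·laurent A B ε n j d − λ·(p^{Ld}·laurent A B 0 N J d))
  ≤ exp(−(L+1))`; **`residueLaw_circ`** (cells `s ≥ 1`, `d = A − s`); **`residueLaw_circ_zero`** (harmonic cell):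
  `v(p^{(L+1)A}·cellZero A B ε n j − λ·(p^{LA}·cellZero A B 0 N J)) ≤ exp(−(L+1))`;
* the mechanism `strip_coeff_le`: the series `W = a·E_j·U` of (★) (`rescale_p F_j = F̃_J·W`) has `W(0) = λ` and
  `[T^g]W ∈ pℤ_(p)` for every `g ≥ 1`.
These supersede `BrickResidueLawMain.residueLaw_main{,_zero}` (main case only), whose hypotheses they weaken.
-/

namespace Summit.KontsevichZagierPeriods.Zeta5Search.BrickResidueLawCirc

open Finset Nat Polynomial WithZero
open Summit.KontsevichZagierPeriods.Zeta5Search.BrickTopCoefficient (cTop)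
open Summit.KontsevichZagierPeriods.Zeta5Search.BrickLaurent (laurent cell laurent_zero)
open Summit.KontsevichZagierPeriods.Zeta5Search.BrickPartialFractions (cellZero)
open Summit.KontsevichZagierPeriods.Zeta5Search.ScaledSeries (IsSlopeInt)
open Summit.KontsevichZagierPeriods.Zeta5Search.BrickLambda (le_one_of_cong cTop_zero_ne_zero)
open Summit.KontsevichZagierPeriods.Zeta5Search.BrickHarmonicBlocks (hsum)
open Summit.KontsevichZagierPeriods.Zeta5Search.BrickDigitStepDZero (cellZero_eq)
open Summit.KontsevichZagierPeriods.Zeta5Search.BrickResidueLawMain (cong_mul_le level_hsum_sub_le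
  level_laurent_integral level_hsum_integral)
open Summit.KontsevichZagierPeriods.Zeta5Search.BrickDigitStripCirc (centreCarry carryPoly carryPoly_eval_zero_ne_zero
  isSlopeInt_carryPoly laurent_rescale_eq_sum_circ centreCarry_le_one)
open Summit.KontsevichZagierPeriods.Zeta5Search.BrickDigitStripCarry (div_two_carry_le_one)
open Summit.KontsevichZagierPeriods.Zeta5Search.BrickLambdaCirc (padicValuation_stripConst padicValuation_cTop_circ
  padicValuation_carryPoly_eval_zero)

noncomputable section

variable {p : ℕ} [Fact p.Prime]

/-! ## The boundary polynomial has degree `m` and `ℤ_(p)` coefficients -/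

omit [Fact p.Prime] in
/-- `deg E_j ≤ m = B c_a + B c_b + ε c_c`. -/
theorem natDegree_carryPoly_le (B ε N n₀ J j₀ : ℕ) :
    (carryPoly p B ε N n₀ J j₀).natDegree ≤
      B * ((n₀ + j₀) / p) + B * ((n₀ + (n₀ - j₀)) / p) + ε * centreCarry p (n₀ + N * p) (j₀ + J * p) := by
  unfold carryPoly
  refine (natDegree_mul_le.trans (Nat.add_le_add (natDegree_mul_le.trans (Nat.add_le_add ?_ ?_)) ?_)) <;>
    refine natDegree_pow_le.trans ?_ <;> rw [natDegree_X_add_C, mul_one]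

/-- The coefficients of `E_j` are `p`-integral (odd `p`). -/
theorem padicValuation_coeff_carryPoly_le (hp2 : p ≠ 2) (B ε N n₀ J j₀ h : ℕ) :
    Rat.padicValuation p ((carryPoly p B ε N n₀ J j₀).coeff h) ≤ 1 := by
  have := isSlopeInt_carryPoly (p := p) hp2 B ε N n₀ J j₀ h
  rwa [zero_mul, zero_add, exp_zero, Polynomial.coeff_coe] at this

/-- **The paid boundary polynomial**: if `v(a) ≤ exp(−m)` then `a·[T^h]E_j ∈ pℤ_(p)` for every `h ≥ 1`
(for `h ≤ m` because `m ≥ 1`; for `h > m` the coefficient vanishes). -/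
theorem strip_coeff_le (hp2 : p ≠ 2) {B ε N n₀ J j₀ : ℕ} {a : ℚ}
    (ha : Rat.padicValuation p a ≤ exp (-((B * ((n₀ + j₀) / p) + B * ((n₀ + (n₀ - j₀)) / p) +
      ε * centreCarry p (n₀ + N * p) (j₀ + J * p) : ℕ) : ℤ))) {h : ℕ} (hh : 1 ≤ h) :
    Rat.padicValuation p (a * (carryPoly p B ε N n₀ J j₀).coeff h) ≤ exp (-1 : ℤ) := by
  set m := B * ((n₀ + j₀) / p) + B * ((n₀ + (n₀ - j₀)) / p) + ε * centreCarry p (n₀ + N * p) (j₀ + J * p) with hm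
  by_cases hhm : h ≤ m
  · rw [map_mul]
    calc _ ≤ exp (-(m : ℤ)) * 1 := mul_le_mul' ha (padicValuation_coeff_carryPoly_le hp2 B ε N n₀ J j₀ h)
      _ ≤ exp (-1 : ℤ) := by rw [mul_one, exp_le_exp]; omega
  · rw [coeff_eq_zero_of_natDegree_lt ((natDegree_carryPoly_le (p := p) B ε N n₀ J j₀).trans_lt (by omega)),
      mul_zero, map_zero]
    exact _root_.zero_le

/-! ## The residue law for ° cells -/

section circ

variable (hp2 : p ≠ 2) {A B ε N n₀ J j₀ n j L : ℕ} (hAB : 2 * B ≤ A) (hn : n = n₀ + N * p) (hj : j = j₀ + J * p)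
  (hN : N < p ^ (L + 1)) (hn₀ : n₀ < p) (hj₀ : j₀ ≤ n₀) (hJN : J ≤ N) (hcen : 2 * j ≠ n ∨ ε = 0)
include hp2 hAB hn hj hn₀ hj₀ hJN hcen

omit hAB hcen in
/-- **The multiplier of a ° cell** — any `λ` with `λ·c̃_{J,A}(N) = c_{j,A}(n)`, i.e. `λ_j = c_{j,A}(n)/c̃_{J,A}(N)` — has
`v(λ_j) ≤ exp(−m)`; in particular `λ_j ∈ ℤ_(p)` (THEOREM 7 LEMMA 3 (ii) for `c_h = 0`; at the exact centre `λ = 0`). -/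
theorem lambda_circ {lam : ℚ} (hlam : lam * cTop A B 0 N J = cTop A B ε n j) : Rat.padicValuation p lam ≤
    exp (-((B * ((n₀ + j₀) / p) + B * ((n₀ + (n₀ - j₀)) / p) + ε * centreCarry p n j : ℕ) : ℤ)) := by
  subst hn hj
  have hlam' : lam = cTop A B ε (n₀ + N * p) (j₀ + J * p) / cTop A B 0 N J := by
    rw [← hlam, mul_div_cancel_right₀ _ (cTop_zero_ne_zero hJN A B)]
  rw [hlam', map_div₀, padicValuation_cTop_circ hp2 hn₀ hj₀ hJN, mul_assoc, mul_div_assoc,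
    mul_div_cancel_right₀ _ ((Valuation.ne_zero_iff _).2 (cTop_zero_ne_zero hJN A B))]
  calc _ ≤ exp (-((B * ((n₀ + j₀) / p) + B * ((n₀ + (n₀ - j₀)) / p) +
        ε * centreCarry p (n₀ + N * p) (j₀ + J * p) : ℕ) : ℤ)) * 1 :=
        mul_le_mul' le_rfl (by rw [← coeff_zero_eq_eval_zero]; exact padicValuation_coeff_carryPoly_le hp2 _ _ _ _ _ _ _)
    _ = _ := mul_one _

omit hAB hcen in
/-- `λ_j ∈ ℤ_(p)` for a ° cell. -/
theorem lambda_circ_le_one {lam : ℚ} (hlam : lam * cTop A B 0 N J = cTop A B ε n j) :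
    Rat.padicValuation p lam ≤ 1 :=
  (lambda_circ hp2 hn hj hn₀ hj₀ hJN hlam).trans (by rw [← exp_zero, exp_le_exp]; omega)

include hN

/-- **LEMMA 2 (ii), EVERY ° cell, every level, every depth `d`** (`[T^d]F = c_{·,A−d}`):
`v(p^{(L+1)d}·[T^d]F_j^{(n)} − λ_j·p^{Ld}·[T^d]F̃_J^{(N)}) ≤ exp(−(L+1))` for any `λ_j` with `λ_j·c̃_{J,A}(N) = c_{j,A}(n)`
— no hypothesis on `L`. -/
theorem residueLaw_circ_depth {lam : ℚ} (hmul : lam * cTop A B 0 N J = cTop A B ε n j) (d : ℕ) :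
    Rat.padicValuation p ((p : ℚ) ^ ((L + 1) * d) * laurent A B ε n j d -
      lam * ((p : ℚ) ^ (L * d) * laurent A B 0 N J d)) ≤ exp (-((L : ℤ) + 1)) := by
  have hp : p.Prime := Fact.out
  subst hn hj
  obtain ⟨U, hU0, hUint, a, hsum, hlam⟩ :=
    laurent_rescale_eq_sum_circ (p := p) hp2 (A := A) (B := B) (ε := ε) hn₀ hj₀ hJN rfl rfl
  have hva := padicValuation_stripConst (p := p) hp2 hn₀ hj₀ hJN hAB rfl rfl hcen hlam
  have hva1 : Rat.padicValuation p a ≤ 1 := hva.le.trans (by rw [← exp_zero, exp_le_exp]; omega)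
  have hjn : j₀ + J * p ≤ n₀ + N * p := by nlinarith
  set E : ℚ[X] := carryPoly p B ε N n₀ J j₀ with hE
  -- the series `W = a·E·U` and its coefficients
  set w : ℕ → ℚ := fun g => a * PowerSeries.coeff g ((E : PowerSeries ℚ) * U) with hw
  have hw0 : w 0 = lam := by
    rw [laurent_zero hAB 0 hJN, laurent_zero hAB ε hjn, ← hmul] at hlam
    rw [hw]
    simp only
    rw [PowerSeries.coeff_zero_eq_constantCoeff_apply, map_mul, hU0, mul_one, Polynomial.constantCoeff_coe,
      coeff_zero_eq_eval_zero]
    exact mul_right_cancel₀ (cTop_zero_ne_zero hJN A B) hlam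
  have hwg : ∀ g, 1 ≤ g → Rat.padicValuation p (w g) ≤ exp (-1 : ℤ) := by
    intro g hg
    rw [hw]
    simp only
    rw [PowerSeries.coeff_mul, Finset.mul_sum]
    refine Valuation.map_sum_le _ fun x hx => ?_
    have hx' := mem_antidiagonal.1 hx
    rw [← mul_assoc, map_mul, Polynomial.coeff_coe]
    rcases Nat.eq_zero_or_pos x.2 with h2 | h2
    · have h1 : 1 ≤ x.1 := by omega
      have hU2 : Rat.padicValuation p (PowerSeries.coeff x.2 U) ≤ 1 := by
        have := hUint x.2; rw [h2, Nat.cast_zero, mul_zero, add_zero, exp_zero] at this; rwa [h2]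
      calc _ ≤ exp (-1 : ℤ) * 1 := mul_le_mul' (strip_coeff_le hp2 hva.le h1) hU2
        _ = _ := mul_one _
    · have hx2 : (1 : ℤ) ≤ x.2 := by exact_mod_cast h2
      have hU2 : Rat.padicValuation p (PowerSeries.coeff x.2 U) ≤ exp (-1 : ℤ) :=
        (hUint x.2).trans (by rw [exp_le_exp]; omega)
      have haE : Rat.padicValuation p (a * E.coeff x.1) ≤ 1 := by
        rw [map_mul]; exact mul_le_one' hva1 (padicValuation_coeff_carryPoly_le hp2 _ _ _ _ _ _ _)
      calc _ ≤ 1 * exp (-1 : ℤ) := mul_le_mul' haE hU2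
        _ = _ := one_mul _
  -- `p^{Lg}·[T^g]W` pays `p^{L+1}` for `g ≥ 1`
  have hW : ∀ g, 1 ≤ g → Rat.padicValuation p ((p : ℚ) ^ (L * g) * w g) ≤ exp (-((L : ℤ) + 1)) := by
    intro g hg
    have hg1 : (1 : ℤ) ≤ g := by exact_mod_cast hg
    rw [map_mul, map_pow, Rat.padicValuation_self, ← exp_nsmul]
    refine (mul_le_mul' le_rfl (hwg g hg)).trans ?_
    rw [← exp_add, exp_le_exp, nsmul_eq_mul]
    push_cast
    nlinarith [mul_nonneg (Int.natCast_nonneg L) (sub_nonneg.2 hg1)]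
  -- the two-scale expansion with the `g = 0` term split off
  rw [← hw0]
  set S : ℚ := ∑ k ∈ range d, laurent A B 0 N J k * w (d - k) with hS
  have hd : (p : ℚ) ^ d * laurent A B ε (n₀ + N * p) (j₀ + J * p) d = S + laurent A B 0 N J d * w 0 := by
    rw [hsum d, Finset.mul_sum]
    have : ∀ x ∈ antidiagonal d, a * (laurent A B 0 N J x.1 * PowerSeries.coeff x.2 ((E : PowerSeries ℚ) * U)) =
        laurent A B 0 N J x.1 * w x.2 := fun x _ => by rw [hw]; ring
    rw [Finset.sum_congr rfl this, Finset.Nat.sum_antidiagonal_eq_sum_range_succ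
      (fun e g => laurent A B 0 N J e * w g) d, Finset.sum_range_succ, Nat.sub_self]
  have hPS : (p : ℚ) ^ (L * d) * S =
      ∑ k ∈ range d, ((p : ℚ) ^ (L * k) * laurent A B 0 N J k) * ((p : ℚ) ^ (L * (d - k)) * w (d - k)) := by
    rw [hS, Finset.mul_sum]
    refine Finset.sum_congr rfl fun k hk => ?_
    have hk' := mem_range.1 hk
    rw [show L * d = L * k + L * (d - k) by rw [← mul_add]; congr 1; omega, pow_add]
    ring
  rw [show (p : ℚ) ^ ((L + 1) * d) * laurent A B ε (n₀ + N * p) (j₀ + J * p) d =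
      (p : ℚ) ^ (L * d) * ((p : ℚ) ^ d * laurent A B ε (n₀ + N * p) (j₀ + J * p) d) by
      rw [show (L + 1) * d = L * d + d by ring, pow_add, mul_assoc], hd,
    show (p : ℚ) ^ (L * d) * (S + laurent A B 0 N J d * w 0) - w 0 * ((p : ℚ) ^ (L * d) * laurent A B 0 N J d) =
      (p : ℚ) ^ (L * d) * S by ring, hPS]
  refine Valuation.map_sum_le _ fun k hk => ?_
  have hk' := mem_range.1 hk
  rw [map_mul]
  calc _ ≤ 1 * exp (-((L : ℤ) + 1)) := mul_le_mul' (level_laurent_integral hp2 hAB hN hJN k) (hW (d - k) (by omega))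
    _ = _ := one_mul _

/-- **LEMMA 2 (ii), EVERY ° cell, every level, cells `s ≥ 1`**: with `r_j^{(s)} = p^{Λ(A−s)}c_{j,s}`, `Λ = L+1`:
`v(p^{(L+1)(A−s)}·c_{j,s}(n) − λ_j·p^{L(A−s)}·c̃_{J,s}(N)) ≤ exp(−(L+1))` (`λ_j·c̃_{J,A}(N) = c_{j,A}(n)`; no hypothesis
on `L`; supersedes `BrickResidueLawMain.residueLaw_main`, whose main-case hypotheses are dropped). -/
theorem residueLaw_circ {lam : ℚ} (hmul : lam * cTop A B 0 N J = cTop A B ε n j) (s : ℕ) :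
    Rat.padicValuation p ((p : ℚ) ^ ((L + 1) * (A - s)) * cell A B ε n j s -
      lam * ((p : ℚ) ^ (L * (A - s)) * cell A B 0 N J s)) ≤ exp (-((L : ℤ) + 1)) :=
  residueLaw_circ_depth hp2 hAB hn hj hN hn₀ hj₀ hJN hcen hmul (A - s)

/-- **LEMMA 2 (ii), EVERY ° cell, every level, the harmonic cell `s = 0`**:
`v(p^{(L+1)A}·cell^{(0)}_j(n) − λ_j·p^{LA}·cell̃^{(0)}_J(N)) ≤ exp(−(L+1))` (`λ_j·c̃_{J,A}(N) = c_{j,A}(n)`; supersedes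
`BrickResidueLawMain.residueLaw_main_zero`). -/
theorem residueLaw_circ_zero {lam : ℚ} (hmul : lam * cTop A B 0 N J = cTop A B ε n j) :
    Rat.padicValuation p ((p : ℚ) ^ ((L + 1) * A) * cellZero A B ε n j -
      lam * ((p : ℚ) ^ (L * A) * cellZero A B 0 N J)) ≤ exp (-((L : ℤ) + 1)) := by
  have hp : p.Prime := Fact.out
  have hJ : j / p = J := by rw [hj, Nat.add_mul_div_right _ _ hp.pos, Nat.div_eq_of_lt (by omega), zero_add]
  have hJlt : J < p ^ (L + 1) := lt_of_le_of_lt hJN hN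
  have hlt1 : exp (-((L : ℤ) + 1)) < 1 := by rw [← exp_zero, exp_lt_exp]; omega
  set r : ℚ := lam with hr
  have hr1 : Rat.padicValuation p r ≤ 1 := lambda_circ_le_one hp2 hn hj hn₀ hj₀ hJN hmul
  have hx : (p : ℚ) ^ ((L + 1) * A) * cellZero A B ε n j =
      -∑ s ∈ Icc 1 A, ((p : ℚ) ^ ((L + 1) * (A - s)) * cell A B ε n j s) * ((p : ℚ) ^ ((L + 1) * s) * hsum s j) := by
    rw [cellZero_eq, mul_neg, Finset.mul_sum]
    congr 1
    refine Finset.sum_congr rfl fun s hs => ?_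
    have hs' := mem_Icc.1 hs
    rw [show (p : ℚ) ^ ((L + 1) * A) = (p : ℚ) ^ ((L + 1) * (A - s)) * (p : ℚ) ^ ((L + 1) * s) by
      rw [← pow_add, ← mul_add, Nat.sub_add_cancel hs'.2]]
    ring
  have hy : r * ((p : ℚ) ^ (L * A) * cellZero A B 0 N J) =
      -∑ s ∈ Icc 1 A, (r * ((p : ℚ) ^ (L * (A - s)) * cell A B 0 N J s)) * ((p : ℚ) ^ (L * s) * hsum s J) := by
    rw [cellZero_eq, mul_neg, mul_neg, Finset.mul_sum, Finset.mul_sum]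
    congr 1
    refine Finset.sum_congr rfl fun s hs => ?_
    have hs' := mem_Icc.1 hs
    rw [show (p : ℚ) ^ (L * A) = (p : ℚ) ^ (L * (A - s)) * (p : ℚ) ^ (L * s) by
      rw [← pow_add, ← mul_add, Nat.sub_add_cancel hs'.2]]
    ring
  rw [hx, hy, neg_sub_neg, ← Finset.sum_sub_distrib]
  refine Valuation.map_sum_le _ fun s hs => ?_
  have hs' := mem_Icc.1 hs
  rw [Valuation.map_sub_swap]
  have hlaw := residueLaw_circ_depth hp2 hAB hn hj hN hn₀ hj₀ hJN hcen hmul (A - s)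
  have hH := level_hsum_sub_le (p := p) hs'.1 L j
  rw [hJ] at hH
  have hy₁ : Rat.padicValuation p (r * ((p : ℚ) ^ (L * (A - s)) * cell A B 0 N J s)) ≤ 1 := by
    rw [map_mul]; exact mul_le_one' hr1 (level_laurent_integral hp2 hAB hN hJN (A - s))
  exact cong_mul_le hlaw hH (le_one_of_cong (lt_of_le_of_lt hlaw hlt1) hy₁) (level_hsum_integral hJlt s)

end circ

end

end Summit.KontsevichZagierPeriods.Zeta5Search.BrickResidueLawCirc
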